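import Mathlib
import Summits.CriticalPhenomena.PercolationContinuityZ3.Theorems.PercNearOneGluingNearOneGluingKnLemma3i
import Summits.CriticalPhenomena.PercolationContinuityZ3.Theorems.PercNearOneGluingNearOneGluingMaxattTwo
import Literature.Probability.Percolation.TwoClusterConditionalAssociationProofs
import HarnessLib

/-!
# Crux `PercNearOneGluing.NearOneGluing` (stmt-CriticalPhenomena-4574), line `SketchR2I5` — stub `stub_attachAloneRescueBound`

Helper file for the crux (lead prover-line-stmt-CriticalPhenomena-4574-c4): the second
correlation lemma of the glued-graph reduction of the `|A| = 3` case of the MAXATT /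
least-reliable-first gluing inequality.  Proves exactly the registered stub signature; lands with
`--supports stmt-CriticalPhenomena-4574`.

## Content

Finite weighted graph on `Fin n`, `μ = prodBernoulli w` on bond configurations
`ω : Set (Sym2 (Fin n))`, target `b`, source `o`, two relays `y, z`, vertex sets `S, S'`.
Attachment events `Y = {o ↔ y inside S}` (increasing in the open edge cluster of `y`) and
`Zt = {o ↔ z inside S'}` (increasing in the open edge cluster of `z`), `D = {y ↮ z}` and the
rescue event `g = {z ↔ b} ∩ {y ↮ b}` (`⊆ D`).
THEOREM (`stub_attachAloneRescueBound`): **`μ(D) · μ((Y ∖ Zt) ∩ g) ≤ μ((Y ∖ Zt) ∩ D) · μ(g)`.**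

Proof.  If `y = z` then `D = ∅` and the left side vanishes.  Otherwise
van den Berg–Häggström–Kahn (2006), Thm. 1.5 (`BHK2006_twoClusterConditionalAssociation_holds`,
proved in the tree) for `s = y`, `t = z`, `F(C_y, C_z) = 1{C_y witnesses Y} · (1 − 1{C_z witnesses Zt})`
(increasing in `C_y`, decreasing in `C_z`) and `G(C_y, C_z) = 1 − 1{C_z witnesses z ↔ b}`
(decreasing in `C_z`) reads `(∫_D F)(∫_D G) ≤ μ(D) ∫_D F G`, i.e.
`μ((Y ∖ Zt) ∩ D) · (μ(D) − μ(D ∩ {z ↔ b})) ≤ μ(D) · (μ((Y ∖ Zt) ∩ D) − μ((Y ∖ Zt) ∩ D ∩ {z ↔ b}))`,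
i.e. `μ(D) μ((Y ∖ Zt) ∩ D ∩ {z ↔ b}) ≤ μ((Y ∖ Zt) ∩ D) μ(D ∩ {z ↔ b})`; finally
`D ∩ {z ↔ b} = g` (on `D`, `z ↔ b` forces `y ↮ b`; and `z ↔ b ∧ y ↮ b` forces `y ↮ z`).
-/

namespace Summit.CriticalPhenomena.PercolationContinuityZ3.Theorems

open MeasureTheory Set Literature.Probability.LatticeModels Literature.Probability.Percolation
open scoped Classical BigOperators

section AttachAloneRescueBound

universe u

variable {V : Type u} [Fintype V]

/-- **BHK (2006) Thm. 1.5 with `f = 1_P · (1 − 1_Q)`, `g = 1 − 1{t ↔ b}`** (`P` increasing and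
determined by `C_s`, `Q` increasing and determined by `C_t`; `f` is increasing in `C_s` and
decreasing in `C_t`, `g` is decreasing in `C_t`): for `D = {s ↮ t}`,
`μ(D ∩ (P ∖ Q)) · μ(D ∩ {t ↮ b}) ≤ μ(D) · μ(D ∩ ((P ∖ Q) ∩ {t ↮ b}))`.
[cite: VandenbergHaggstromKahn2005, Thm. 1.5 (p. 7, eq. (9))] -/
theorem attachAloneRescueBound_twoCluster (w : Sym2 V → unitInterval) (s t b : V)
    (P Q : Set (BondConfig V))
    (hP : ∀ ω ω', ω ∈ P → openEdgeCluster ω s ⊆ openEdgeCluster ω' s → ω' ∈ P)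
    (hQ : ∀ ω ω', ω ∈ Q → openEdgeCluster ω t ⊆ openEdgeCluster ω' t → ω' ∈ Q) (hst : s ≠ t) :
    (prodBernoulli w).real ((openConn s t)ᶜ ∩ (P \ Q)) *
        (prodBernoulli w).real ((openConn s t)ᶜ ∩ (openConn t b)ᶜ) ≤
      (prodBernoulli w).real (openConn s t)ᶜ *
        (prodBernoulli w).real ((openConn s t)ᶜ ∩ ((P \ Q) ∩ (openConn t b)ᶜ)) := by
  have key := BHK2006_twoClusterConditionalAssociation_holds V w s t
    (fun C D => {C' : Set (Sym2 V) | ∃ ω ∈ P, openEdgeCluster ω s ⊆ C'}.indicator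
        (1 : Set (Sym2 V) → ℝ) C *
      (1 - {C' : Set (Sym2 V) | ∃ ω ∈ Q, openEdgeCluster ω t ⊆ C'}.indicator
        (1 : Set (Sym2 V) → ℝ) D))
    (fun _ D => 1 - connIndicatorFn t b D)
    (fun D _ _ h => mul_le_mul_of_nonneg_right (knLemma3i_monotone_indicator_upClosure P s h)
      (sub_nonneg.2 (Set.indicator_apply_le' (fun _ => le_rfl) (fun _ => zero_le_one))))
    (fun C _ _ h => mul_le_mul_of_nonneg_left
      (sub_le_sub_left (knLemma3i_monotone_indicator_upClosure Q t h) 1)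
      (Set.indicator_nonneg (fun _ _ => zero_le_one) _))
    (fun _ => monotone_const)
    (fun _ _ _ h => sub_le_sub_left (monotone_connIndicatorFn t b h) 1) hst
  have hD : {ω : BondConfig V | ¬ (openGraph ω).Reachable s t} = (openConn s t)ᶜ := rfl
  have hm : ∀ E : Set (BondConfig V), MeasurableSet E := fun _ => MeasurableSet.of_discrete
  simp only [connIndicatorFn_openEdgeCluster, knLemma3i_indicator_upClosure_openEdgeCluster hP,
    knLemma3i_indicator_upClosure_openEdgeCluster hQ, hD] at key
  -- pointwise identities of indicators
  have e1 : ∀ ω : BondConfig V, P.indicator (1 : BondConfig V → ℝ) ω *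
      (1 - Q.indicator (1 : BondConfig V → ℝ) ω) = (P \ Q).indicator 1 ω := by
    intro ω
    by_cases h1 : ω ∈ P <;> by_cases h2 : ω ∈ Q <;> simp [h1, h2]
  have e2 : ∀ ω : BondConfig V, (1 : ℝ) - (openConn t b).indicator (1 : BondConfig V → ℝ) ω =
      (openConn t b)ᶜ.indicator 1 ω := by
    intro ω
    by_cases h : ω ∈ openConn t b <;> simp [h]
  have e3 : ∀ ω : BondConfig V, (P \ Q).indicator (1 : BondConfig V → ℝ) ω
      * (openConn t b)ᶜ.indicator (1 : BondConfig V → ℝ) ω =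
        ((P \ Q) ∩ (openConn t b)ᶜ).indicator 1 ω :=
    fun ω => (congrFun (Set.inter_indicator_one (s := P \ Q)
      (t := (openConn t b)ᶜ) (M₀ := ℝ)) ω).symm
  simp only [e1, e2, e3] at key
  rw [setIntegral_indicator (hm _), setIntegral_indicator (hm _), setIntegral_indicator (hm _)]
    at key
  simpa only [Pi.one_apply, setIntegral_const, smul_eq_mul, mul_one] using key

end AttachAloneRescueBound

/-- **The piece "`y` attached, `z` not" is nonpositively correlated with "`z` alive", given
`y ↮ z`.**  With `Y := openConnIn S o y`, `Zt := openConnIn S' o z`, `D := {y ↮ z}` and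
`g := {z ↔ b} ∩ {y ↮ b}` (`⊆ D`): `μ(D) · μ((Y ∖ Zt) ∩ g) ≤ μ((Y ∖ Zt) ∩ D) · μ(g)`.
From van den Berg–Häggström–Kahn (2006) Thm. 1.5 for the pair `(y, z)`
(`attachAloneRescueBound_twoCluster`) and the set identity `D ∩ {z ↔ b} = g`.
[cite: VandenbergHaggstromKahn2005, Thm. 1.5 (p. 7)] -/
theorem stub_attachAloneRescueBound :
    ∀ (n : ℕ) (w : Sym2 (Fin n) → unitInterval) (S S' : Set (Fin n)) (o b y z : Fin n),
      (prodBernoulli w).real (openConn y z)ᶜ *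
          (prodBernoulli w).real ((openConnIn S o y \ openConnIn S' o z) ∩ (openConn z b ∩ (openConn y b)ᶜ)) ≤
        (prodBernoulli w).real ((openConnIn S o y \ openConnIn S' o z) ∩ (openConn y z)ᶜ) *
          (prodBernoulli w).real (openConn z b ∩ (openConn y b)ᶜ) := by
  intro n w S S' o b y z
  have hm : ∀ E : Set (BondConfig (Fin n)), MeasurableSet E := fun _ => MeasurableSet.of_discrete
  rcases eq_or_ne y z with hyz | hyz
  · subst hyz
    have hDe : (openConn y y : Set (BondConfig (Fin n)))ᶜ = ∅ :=
      Set.compl_empty_iff.2 (Set.eq_univ_of_forall fun ω => SimpleGraph.Reachable.refl _)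
    rw [hDe, measureReal_empty, zero_mul]
    exact mul_nonneg measureReal_nonneg measureReal_nonneg
  -- BHK Thm. 1.5 for `(y, z)`
  have key := attachAloneRescueBound_twoCluster w y z b (openConnIn S o y) (openConnIn S' o z)
    (maxattTwo_openConnIn_mono_openEdgeCluster S o y)
    (maxattTwo_openConnIn_mono_openEdgeCluster S' o z) hyz
  -- notation
  set μ := prodBernoulli w with hμ
  set R : Set (BondConfig (Fin n)) := openConnIn S o y \ openConnIn S' o z with hR
  set D : Set (BondConfig (Fin n)) := (openConn y z)ᶜ with hD
  -- `g = D ∩ {z ↔ b}`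
  have hg : (openConn z b ∩ (openConn y b)ᶜ : Set (BondConfig (Fin n))) = D ∩ openConn z b := by
    ext ω
    constructor
    · rintro ⟨h1, h2⟩
      exact ⟨fun h3 => h2 (SimpleGraph.Reachable.trans h3 h1), h1⟩
    · rintro ⟨h1, h2⟩
      exact ⟨h2, fun h3 => h1 (SimpleGraph.Reachable.trans h3 (SimpleGraph.Reachable.symm h2))⟩
  have hsplit : ∀ A B : Set (BondConfig (Fin n)), μ.real (A ∩ Bᶜ) = μ.real A - μ.real (A ∩ B) := by
    intro A B
    have h := measureReal_inter_add_sdiff (μ := μ) (s := A) (t := B) (hm B)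
    rw [Set.sdiff_eq_compl_inter, Set.inter_comm Bᶜ A] at h
    linarith
  rw [show D ∩ (R ∩ (openConn z b)ᶜ) = (D ∩ R) ∩ (openConn z b)ᶜ from (Set.inter_assoc _ _ _).symm,
    hsplit D (openConn z b), hsplit (D ∩ R) (openConn z b)] at key
  -- `key : μ (D ∩ R) * (μ D - μ (D ∩ {z↔b})) ≤ μ D * (μ (D ∩ R) - μ (D ∩ R ∩ {z↔b}))`
  rw [hg, show R ∩ (D ∩ openConn z b) = D ∩ R ∩ openConn z b by
      rw [← Set.inter_assoc, Set.inter_comm R D], Set.inter_comm R D]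
  nlinarith [key]

end Summit.CriticalPhenomena.PercolationContinuityZ3.Theorems
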